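import Mathlib
import HarnessLib
import Summits.ResolutionOfSingularities.ResolutionOfSingularities.Theorems.WildQuotientsWildQuotientResolutionS1aBlowupChartNode
import Summits.ResolutionOfSingularities.ResolutionOfSingularities.Theorems.WildQuotientsWildQuotientResolutionS1aKillFreeCert

/-!
# S1a — K-FREE FRAME, (F-T8) core: the PRODUCER node of a blow-up chart WITH ITS PIN, and principality certificates computed in the chart ring

[OURS · L1 W4.5c · lead-1 g12; plan-1 A-KF v1 §2.4 «(F-T8) AUX DECORATION — the data version of `exists_isNodeChart_of_isCentreChart` must expose
B′ = R^w(B)[(y_jT^{d̄})⁻¹] with σ′ = sigmaChart and e′ … so that identities in B′ are checked in the chart ring», RULING R-F15b (6) «(F-T8) per chart =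
NodeData of the norm chart … + idle/restricted charts off supp»] — NOT statements of the manuscript; counted 0; AI-level work, weaker than expert review.
Crux stmt-ResolutionOfSingularities-17941 `CyclicQuotientFourfolds`, line `s1a-logminvertex` v12 (`stub_reachLowerInF`). Realisation-agnostic (any
equivariant action upstairs, `hcomm`), so usable inside `TreeF` MOVE nodes.

`exists_nodeData_blowupChart` (✓p628829) exposes the node `(ChartRing 𝒜 f w dbar y, chartNodeGrading, sigmaChart, E)` of the chart `V′[O, e⁻¹ y]` at a
σ-fixed cover element `y ∈ K_{dbar}` but not how `E` reads PULLED-BACK SECTIONS. Here: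
* ★ `exists_nodeData_blowupChart_pin` — the same node data PLUS THE PIN `E (π^* x) = toChartRing (e x)` for every `x ∈ Γ(V, O)` (from the pins of
  `exists_ringEquiv_blowupChart`, `awayEquiv_reesChartBase`, `coarseChartMap_reesChartBase`);
* ★ `principalNear_producerChart_of_certificate` — for the node data built from such an `E` (structure literal, so `D′.B` IS the chart ring): a
  certificate `β′ · (toChartRing (e x))^k ∈ aug σ′` in the CHART RING with `aug σ′ ≤ (β′)`, at a point `u′` of the chart over `D(x)`, gives
  `PrincipalNear` at `u′` ((F-T9) `principalNear_of_certificate` + the pin); `principalNear_producerChart_of_certificate_upstairs` — the same with an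
  upstairs degree-0 element `z` (`c := E⁻¹ z`).
-/

set_option linter.dupNamespace false

noncomputable section

open CategoryTheory AlgebraicGeometry TopologicalSpace Polynomial
open Literature.AlgebraicGeometry.Resolution Literature.AlgebraicGeometry.RelativeSpec
open Summit.ResolutionOfSingularities.ResolutionOfSingularities.Theorems.WildQuotientResolution.S1
open Summit.ResolutionOfSingularities.ResolutionOfSingularities.Theorems.WildQuotientResolution.S1.ProducerStep
open Summit.ResolutionOfSingularities.ResolutionOfSingularities.Theorems.WildQuotientResolution.S1.CoarseChart
open Summit.ResolutionOfSingularities.ResolutionOfSingularities.Theorems.WildQuotientResolution.S1.NodeAtlas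
open Summit.ResolutionOfSingularities.ResolutionOfSingularities.Theorems.WildQuotientResolution.S1.MoveStep
open Summit.ResolutionOfSingularities.ResolutionOfSingularities.Theorems.WildQuotientResolution.S1.NpFrame
open Summit.ResolutionOfSingularities.ResolutionOfSingularities.Theorems.WildQuotientResolution.BlowupExit

namespace Summit.ResolutionOfSingularities.ResolutionOfSingularities.Theorems.WildQuotientResolution.S1.BlowupCharts

universe u

section Centre

variable {V' V Y : Scheme.{u}} {π : V' ⟶ V} {q : V ⟶ Y} {I : V.IdealSheafData} {G : Type u} [Group G]
  (ρ : ActionOver q G) {r' : V' ⟶ Y} (ρ' : ActionOver r' G)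
  (hcomm : ∀ g : G, (ρ'.aut g).hom ≫ π = π ≫ (ρ.aut g).hom) {p : ℕ} (g₀ : G)

variable {m : ℕ} (r : Fin m → ℕ) {B : Type u} [CommRing B] (𝒜 : (Π j : Fin m, ZMod (r j)) → AddSubgroup B) [GradedRing 𝒜] {c : ℕ}
  (f : Fin c → B) {δ : Fin c → Π j : Fin m, ZMod (r j)} (w : Fin c → ℕ) (hf : ∀ i, f i ∈ 𝒜 (δ i))

set_option maxHeartbeats 800000 in
include hcomm in
/-- ★ **THE NODE OF THE BLOW-UP CHART, EXPOSED, WITH ITS PIN.** As `exists_nodeData_blowupChart` (centre chart `O` with node `(B, 𝒜, σ, e)` and centre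
`(f, w)`, `I^k` on `O` = the degree-`dbar` trace, a σ-fixed cover element `y ∈ K_{dbar}`, ANY equivariant action upstairs and a stable affine `O'` with
`O'.1 = V′[O, e⁻¹ y]`): an iso `E : Γ(V′, O') ≃ chartNodeGrading 0` making `(ChartRing, chartNodeGrading, sigmaChart)` a tame node intertwining `g₀` — AND
`E` reads pulled-back sections through the structure map: `E (π^* x) = toChartRing (e x)`. [OURS · L1 W4.5c · (F-T8) core] -/
theorem exists_nodeData_blowupChart_pin (hp : 0 < p) (O : ρ.StableAffineOpens) (hO : IsAffineOpen O.1)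
    (σ : B ≃+* B) (e : Γ(V, O.1) ≃+* ↥(𝒜 0)) (htame : IsTameNode p B 𝒜 σ) (hσp : ∀ x : B, (⇑σ)^[p] x = x)
    (hσ : ∀ t : Γ(V, O.1), ((e ((ρ.aut g₀⁻¹).hom.appLE O.1 O.1 (O.2.1 g₀⁻¹).ge t) : ↥(𝒜 0)) : B) = σ ((e t : ↥(𝒜 0)) : B))
    (hw : ∀ i, 0 < w i) (hK1 : RingTheory.Sequence.IsRegular B (List.ofFn f)) (hK1' : IsRegularRing (B ⧸ Ideal.span (Set.range f)))
    (hσJ : ∀ n : ℕ, ((weightedFiltration f w).ideal n).map (σ : B →+* B) ≤ (weightedFiltration f w).ideal n)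
    {k : ℕ} (hπ' : IsBlowup π (I ^ k)) {dbar : ℕ} (hverbar : VeroneseNormalised 𝒜 f w dbar)
    (hJ' : (I ^ k).ideal ⟨O.1, hO⟩ = ((traceFiltration 𝒜 f w).ideal dbar).comap (e : Γ(V, O.1) →+* ↥(𝒜 0)))
    (y : ↥(𝒜 0)) (hy : y ∈ (traceFiltration 𝒜 f w).ideal dbar) (hσy : σ (y : B) = y)
    (O' : ρ'.StableAffineOpens) (hO'eq : O'.1 = blowupChart π (I ^ k) ⟨O.1, hO⟩ (e.symm y)) :
    letI := chartNodeGradedRing r 𝒜 f w hf dbar y hy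
    ∃ E : Γ(V', O'.1) ≃+* ↥(chartNodeGrading r 𝒜 f w hf dbar y hy 0),
      IsTameNode p (ChartRing 𝒜 f w dbar y hy) (chartNodeGrading r 𝒜 f w hf dbar y hy) (sigmaChart 𝒜 f w dbar y hy σ hσJ hp hσp hσy) ∧
        (∀ t' : Γ(V', O'.1),
          ((E ((ρ'.aut g₀⁻¹).hom.appLE O'.1 O'.1 (O'.2.1 g₀⁻¹).ge t') : ↥(chartNodeGrading r 𝒜 f w hf dbar y hy 0)) :
              ChartRing 𝒜 f w dbar y hy) =
            sigmaChart 𝒜 f w dbar y hy σ hσJ hp hσp hσy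
              ((E t' : ↥(chartNodeGrading r 𝒜 f w hf dbar y hy 0)) : ChartRing 𝒜 f w dbar y hy)) ∧
        ∀ (hle : O'.1 ≤ π ⁻¹ᵁ O.1) (x : Γ(V, O.1)),
          ((E (π.appLE O.1 O'.1 hle x) : ↥(chartNodeGrading r 𝒜 f w hf dbar y hy 0)) : ChartRing 𝒜 f w dbar y hy) =
            toChartRing 𝒜 f w dbar y hy (e x) := by
  classical
  obtain ⟨O', hO'G, hO'aff⟩ := O'
  subst hO'eq
  obtain ⟨-, -, hT1, -, hσ𝒜, -⟩ := id htame
  letI := chartNodeGradedRing r 𝒜 f w hf dbar y hy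
  have hxJ : e.symm y ∈ (I ^ k).ideal ⟨O.1, hO⟩ := by
    rw [hJ', Ideal.mem_comap, RingHom.coe_coe, e.apply_symm_apply]; exact hy
  have hxy : e (e.symm y) = y := e.apply_symm_apply y
  have hWle : blowupChart π (I ^ k) ⟨O.1, hO⟩ (e.symm y) ≤ π ⁻¹ᵁ O.1 := blowupChart_le_preimage π (I ^ k) ⟨O.1, hO⟩ (e.symm y)
  obtain ⟨Ψ, hΨ⟩ := exists_ringEquiv_blowupChart hπ' ⟨O.1, hO⟩ (e.symm y) hxJ
  obtain ⟨T, hT⟩ : ∃ T : HomogeneousLocalization.Away (reesGrading ((I ^ k).ideal ⟨O.1, hO⟩)) (reesT (e.symm y) hxJ) ≃+*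
      HomogeneousLocalization.Away (reesGrading ((traceFiltration 𝒜 f w).ideal dbar)) (reesT y hy),
      ∀ s, T (reesChartBase (e.symm y) hxJ s) = reesChartBase y hy (e s) :=
    ⟨awayEquiv e hJ' hxJ hy hxy, awayEquiv_reesChartBase e hJ' hxJ hy hxy⟩
  letI := chartGradedRing 𝒜 f w hf dbar y hy
  letI : GradedRing (reindex (chartGrading 𝒜 f w hf dbar y hy) (consIndexEquiv r)) :=
    reindexGradedRing (chartGrading 𝒜 f w hf dbar y hy) (consIndexEquiv r)
  let e' : HomogeneousLocalization.Away (reesGrading ((traceFiltration 𝒜 f w).ideal dbar)) (reesT y hy) ≃+*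
      ↥(reindex (chartGrading 𝒜 f w hf dbar y hy) (consIndexEquiv r) 0) :=
    ((coarseChartEquiv 𝒜 f w dbar y hy).trans (subringEquivChartGradingZero 𝒜 f w hf dbar y hy hverbar)).trans
      (gradeZeroEquivOfEq (chartGrading 𝒜 f w hf dbar y hy) (reindex (chartGrading 𝒜 f w hf dbar y hy) (consIndexEquiv r))
        (reindex_zero _ _))
  have he' : ∀ t, ((e' t : ↥(reindex (chartGrading 𝒜 f w hf dbar y hy) (consIndexEquiv r) 0)) : ChartRing 𝒜 f w dbar y hy) =
      coarseChartMap 𝒜 f w dbar y hy t :=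
    fun t => rfl
  have htame' : IsTameNode p (ChartRing 𝒜 f w dbar y hy) (chartNodeGrading r 𝒜 f w hf dbar y hy) (sigmaChart 𝒜 f w dbar y hy σ hσJ hp hσp hσy) :=
    isTameNode_reindex (chartGrading 𝒜 f w hf dbar y hy) (consIndexEquiv r) p _
      (chartRing_isTameNode 𝒜 f w hf dbar y hy σ hσJ hp hσp hσy htame hw hK1 hK1' hverbar.1)
  have hE : ∀ u, ((((Ψ.trans T).trans e') u : ↥(reindex (chartGrading 𝒜 f w hf dbar y hy) (consIndexEquiv r) 0)) : ChartRing 𝒜 f w dbar y hy) =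
      coarseChartMap 𝒜 f w dbar y hy (T (Ψ u)) := fun u => he' (T (Ψ u))
  refine ⟨(Ψ.trans T).trans e', htame', fun t' => ?_, fun hle x => ?_⟩
  · refine (hE _).trans (Eq.trans ?_ (congrArg (sigmaChart 𝒜 f w dbar y hy σ hσJ hp hσp hσy) (hE t').symm))
    exact intertwine 𝒜 f w dbar y hy σ hσJ hp hσp hσy hσ𝒜 e hxJ
      (π.appLE ((⟨O.1, hO⟩ : V.affineOpens) : V.Opens) (blowupChart π (I ^ k) ⟨O.1, hO⟩ (e.symm y)) hWle).hom
      ((ρ'.aut g₀⁻¹).hom.appLE (blowupChart π (I ^ k) ⟨O.1, hO⟩ (e.symm y)) (blowupChart π (I ^ k) ⟨O.1, hO⟩ (e.symm y)) (hO'G g₀⁻¹).ge).hom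
      (fun s => (ρ.aut g₀⁻¹).hom.appLE O.1 O.1 (O.2.1 g₀⁻¹).ge s)
      (fun s => appLE_comm_of_le ρ ρ' hcomm O.1 O.2.1 (blowupChart π (I ^ k) ⟨O.1, hO⟩ (e.symm y)) hO'G hWle g₀⁻¹ s)
      hσ Ψ hΨ T hT t'
  · -- the pin: `E (π^* x) = coarseChartMap (T (Ψ (π^* x))) = coarseChartMap (reesChartBase y (e x)) = toChartRing (e x)`
    refine (hE _).trans ?_
    have hΨ' : Ψ (π.appLE O.1 (blowupChart π (I ^ k) ⟨O.1, hO⟩ (e.symm y)) hle x) = reesChartBase (e.symm y) hxJ x := hΨ x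
    rw [hΨ', hT x, coarseChartMap_reesChartBase]

end Centre

/-! ## Principality certificates on a producer chart, computed in the chart ring -/

section Certificate

variable {p : ℕ} {V' V Y : Scheme.{u}} {π : V' ⟶ V} {q : V ⟶ Y} {G : Type u} [Group G] {ρ : ActionOver q G}
  {r' : V' ⟶ Y} {ρ' : ActionOver r' G} {g₀ : G}

variable {m : ℕ} {r : Fin m → ℕ} {B : Type u} [CommRing B] {𝒜 : (Π j : Fin m, ZMod (r j)) → AddSubgroup B} [GradedRing 𝒜] {c : ℕ}
  {f : Fin c → B} {δ : Fin c → Π j : Fin m, ZMod (r j)} {w : Fin c → ℕ} {hf : ∀ i, f i ∈ 𝒜 (δ i)}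
  {σ : B ≃+* B} {hσJ : ∀ n : ℕ, ((weightedFiltration f w).ideal n).map (σ : B →+* B) ≤ (weightedFiltration f w).ideal n}
  {hp : 0 < p} {hσp : ∀ x : B, (⇑σ)^[p] x = x} {dbar : ℕ} {y : ↥(𝒜 0)} {hy : y ∈ (traceFiltration 𝒜 f w).ideal dbar} {hσy : σ (y : B) = y}

/-- ★ **(F-T8)+(F-T9) A CERTIFICATE IN THE CHART RING MAKES THE PRODUCER CHART PRINCIPAL NEAR A POINT.** For the node data on a producer chart `O'` built
(as a structure literal) from an iso `E` as in `exists_nodeData_blowupChart_pin` — so that its node ring IS `ChartRing 𝒜 f w dbar y` and its automorphism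
IS `sigmaChart` —, an element `β′` of the chart ring with `aug σ′ ≤ (β′)` (EX-DIV upstairs, e.g. `augmentationIdeal_sigmaChart_eq_of_admissible`), a
section `x` DOWNSTAIRS with `π u′ ∈ D(x)` and a certificate `β′ · (toChartRing (e x))^k ∈ aug σ′` give `PrincipalNear` at `u′` (`G = ⟨g₀⟩` finite).
[OURS · L1 W4.5c · (F-T8)/(F-T9)] -/
theorem principalNear_producerChart_of_certificate [Finite G] (hG : ∀ g : G, g ∈ Subgroup.zpowers g₀)
    (O : ρ.StableAffineOpens) (e : Γ(V, O.1) ≃+* ↥(𝒜 0)) (O' : ρ'.StableAffineOpens) (hO' : IsAffineOpen O'.1) (hle : O'.1 ≤ π ⁻¹ᵁ O.1)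
    (E : letI := chartNodeGradedRing r 𝒜 f w hf dbar y hy; Γ(V', O'.1) ≃+* ↥(chartNodeGrading r 𝒜 f w hf dbar y hy 0))
    (htame' : letI := chartNodeGradedRing r 𝒜 f w hf dbar y hy;
      IsTameNode p (ChartRing 𝒜 f w dbar y hy) (chartNodeGrading r 𝒜 f w hf dbar y hy) (sigmaChart 𝒜 f w dbar y hy σ hσJ hp hσp hσy))
    (hE : letI := chartNodeGradedRing r 𝒜 f w hf dbar y hy; ∀ t' : Γ(V', O'.1),
      ((E ((ρ'.aut g₀⁻¹).hom.appLE O'.1 O'.1 (O'.2.1 g₀⁻¹).ge t') : ↥(chartNodeGrading r 𝒜 f w hf dbar y hy 0)) : ChartRing 𝒜 f w dbar y hy) =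
        sigmaChart 𝒜 f w dbar y hy σ hσJ hp hσp hσy ((E t' : ↥(chartNodeGrading r 𝒜 f w hf dbar y hy 0)) : ChartRing 𝒜 f w dbar y hy))
    (hpin : letI := chartNodeGradedRing r 𝒜 f w hf dbar y hy; ∀ x : Γ(V, O.1),
      ((E (π.appLE O.1 O'.1 hle x) : ↥(chartNodeGrading r 𝒜 f w hf dbar y hy 0)) : ChartRing 𝒜 f w dbar y hy) = toChartRing 𝒜 f w dbar y hy (e x))
    (β' : ChartRing 𝒜 f w dbar y hy) (hFD1 : augmentationIdeal (sigmaChart 𝒜 f w dbar y hy σ hσJ hp hσp hσy) ≤ Ideal.span {β'})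
    (x : Γ(V, O.1)) {u' : V'} (hu' : u' ∈ O'.1) (hux : π.base u' ∈ V.basicOpen x) {k : ℕ}
    (hk : β' * toChartRing 𝒜 f w dbar y hy (e x) ^ k ∈ augmentationIdeal (sigmaChart 𝒜 f w dbar y hy σ hσJ hp hσp hσy)) :
    letI := chartNodeGradedRing r 𝒜 f w hf dbar y hy
    (({ affine := hO', m := m + 1, r := Fin.cons 0 r, B := ChartRing 𝒜 f w dbar y hy, 𝒜 := chartNodeGrading r 𝒜 f w hf dbar y hy,
        σ := sigmaChart 𝒜 f w dbar y hy σ hσJ hp hσp hσy, e := E, tame := htame', intertwine := hE } : NodeData p ρ' g₀ O')).PrincipalNear u' := by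
  letI := chartNodeGradedRing r 𝒜 f w hf dbar y hy
  refine NodeData.principalNear_of_certificate hG _ β' hFD1 (π.appLE O.1 O'.1 hle x) (u := u') ?_ (k := k) ?_
  · rw [Scheme.basicOpen_appLE]
    exact ⟨hu', hux⟩
  · change β' * ((E (π.appLE O.1 O'.1 hle x) : ↥(chartNodeGrading r 𝒜 f w hf dbar y hy 0)) : ChartRing 𝒜 f w dbar y hy) ^ k ∈ _
    rw [hpin x]
    exact hk

/-- **The same with an UPSTAIRS certificate element**: a degree-0 element `z` of the chart ring (a section `E⁻¹ z` of the producer chart) with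
`u′ ∈ D(E⁻¹ z)` and `β′ · z^k ∈ aug σ′`. [OURS · L1 W4.5c · (F-T8)/(F-T9)] -/
theorem principalNear_producerChart_of_certificate_upstairs [Finite G] (hG : ∀ g : G, g ∈ Subgroup.zpowers g₀)
    (O' : ρ'.StableAffineOpens) (hO' : IsAffineOpen O'.1)
    (E : letI := chartNodeGradedRing r 𝒜 f w hf dbar y hy; Γ(V', O'.1) ≃+* ↥(chartNodeGrading r 𝒜 f w hf dbar y hy 0))
    (htame' : letI := chartNodeGradedRing r 𝒜 f w hf dbar y hy;
      IsTameNode p (ChartRing 𝒜 f w dbar y hy) (chartNodeGrading r 𝒜 f w hf dbar y hy) (sigmaChart 𝒜 f w dbar y hy σ hσJ hp hσp hσy))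
    (hE : letI := chartNodeGradedRing r 𝒜 f w hf dbar y hy; ∀ t' : Γ(V', O'.1),
      ((E ((ρ'.aut g₀⁻¹).hom.appLE O'.1 O'.1 (O'.2.1 g₀⁻¹).ge t') : ↥(chartNodeGrading r 𝒜 f w hf dbar y hy 0)) : ChartRing 𝒜 f w dbar y hy) =
        sigmaChart 𝒜 f w dbar y hy σ hσJ hp hσp hσy ((E t' : ↥(chartNodeGrading r 𝒜 f w hf dbar y hy 0)) : ChartRing 𝒜 f w dbar y hy))
    (β' : ChartRing 𝒜 f w dbar y hy) (hFD1 : augmentationIdeal (sigmaChart 𝒜 f w dbar y hy σ hσJ hp hσp hσy) ≤ Ideal.span {β'})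
    (z : letI := chartNodeGradedRing r 𝒜 f w hf dbar y hy; ↥(chartNodeGrading r 𝒜 f w hf dbar y hy 0)) {u' : V'}
    (huz : letI := chartNodeGradedRing r 𝒜 f w hf dbar y hy; u' ∈ V'.basicOpen (E.symm z)) {k : ℕ}
    (hk : letI := chartNodeGradedRing r 𝒜 f w hf dbar y hy;
      β' * (z : ChartRing 𝒜 f w dbar y hy) ^ k ∈ augmentationIdeal (sigmaChart 𝒜 f w dbar y hy σ hσJ hp hσp hσy)) :
    letI := chartNodeGradedRing r 𝒜 f w hf dbar y hy
    (({ affine := hO', m := m + 1, r := Fin.cons 0 r, B := ChartRing 𝒜 f w dbar y hy, 𝒜 := chartNodeGrading r 𝒜 f w hf dbar y hy,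
        σ := sigmaChart 𝒜 f w dbar y hy σ hσJ hp hσp hσy, e := E, tame := htame', intertwine := hE } : NodeData p ρ' g₀ O')).PrincipalNear u' := by
  letI := chartNodeGradedRing r 𝒜 f w hf dbar y hy
  refine NodeData.principalNear_of_certificate hG _ β' hFD1 (E.symm z) (u := u') huz (k := k) ?_
  change β' * ((E (E.symm z) : ↥(chartNodeGrading r 𝒜 f w hf dbar y hy 0)) : ChartRing 𝒜 f w dbar y hy) ^ k ∈ _
  rw [E.apply_symm_apply]
  exact hk

end Certificate

end Summit.ResolutionOfSingularities.ResolutionOfSingularities.Theorems.WildQuotientResolution.S1.BlowupCharts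

end
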